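import Summits.BirchSwinnertonDyer.BirchSwinnertonDyer.Theses.ShadowIsolation
import Summits.BirchSwinnertonDyer.BirchSwinnertonDyer.Theses.NormCapitulation

/-!
# Crux `ShaCotorsionReducible` (stmt-BirchSwinnertonDyer-15277) — line `eisenstein-norm-capitulation`
# (`Cruxes/ShaCotorsionReducible/Lines/eisenstein_norm_capitulation.lean`; crux-strategist s1, 2026-08-17;
# 5 stubs + kernel-checked composition `ShaCotorsionReducible_of_stubs` concluding the crux BY NAME)

The crux (FIXED; decl `…Theses.ShadowIsolation.ShaCotorsionReducible`, rfl-equal to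
`…Theses.NormCapitulation.ShaCotorsionReducible`): for `W/ℚ` globally minimal elliptic and a prime `p ≥ 5` of
good ordinary reduction at which `E[p]` is REDUCIBLE (a rational `p`-isogeny; by Mazur + CGLS the relevant
primes are `p ∈ {5, 7, 13, 37}`), `corank_{ℤ_p} Ш(E/ℚ)[p^∞] = 0` (`W.shaCorank p = 0`).

## The line (lens: TRANSFER at crux level — the bet route's OWN lever moved into the Eisenstein sector)

Route `NormCapitulation` proves `Ш[p^∞]`-cotorsion on the IRREDUCIBLE sector by the junction
(UniversalNorm #2 → NormHerbrandBound #8) + PhantomCapitulation #3 + CapitulationSqueeze #9, and files the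
reducible sector as this residual crux R "because the mechanism has no grip there". The two crux ideas
`Ideas/eisenstein-norm-capitulation.md` (k1) and `Ideas/universal-norm-eisenstein.md` (k2) observe — and the
literature confirms — that at an Eisenstein prime `p` SPLIT in a Heegner field `K` with `d_K` odd the Λ-adic
input of the junction is a THEOREM WITHOUT ANY IMAGE HYPOTHESIS: Keller–Yin, arXiv:2402.12781 Thm 2 (every
newform, every ordinary Eisenstein `p ∤ N`, every such `K`: `H¹_{F_Λ}(K,𝐓)` and `X = H¹_{F_Λ}(K,M_f)^∨` have
Λ-rank ONE + the Heegner-point main conjecture), extending Castella–Grossi–Lee–Skinner, Invent. Math. 2022 =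
arXiv:2008.02571 Thm 39/41 (`E(K)[p] = 0`). On the irreducible sector the same input (Howard / Cornut–Vatsal)
needs surjective `ρ̄` and `p ∤ h_K` in print — so the Eisenstein sector is the EASIER half of the junction, not
the harder. The line therefore re-runs the route's mechanism on the sector with the Heegner block
strengthened by `p` split in `K` and `d_K` odd (both free: Heegner fields with prescribed splitting exist by
Dirichlet/CRT, exactly as for the route's block):

* `stub_universalNormReducible` (UN_red, OPEN = Mazur's universal-norm conjecture on the sector, the bet):
  some Heegner `K` (block⁺), anticyclotomic `κ`, and the `p`-adic universal-norm datum (verbatim the datum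
  of `NormCapitulation.UniversalNorm`). TRUE when `r_an(E/K) = 1` (α-stabilised Heegner points are norm
  compatible and `𝐳₀ = u_K⁻¹(1-α⁻¹σ_v)(1-α⁻¹σ_v̄)·y_K` has infinite order even at anomalous `p`; CGLS Rem. 42).
* `stub_phantomCapitulationReducible` (CAP_red, OPEN, the route's second bet verbatim on the sector): every
  infinitely `p`-divisible `p`-primary class of `Ш(E/K)` dies in some layer `K_n` (⇐ `T ∤ char_Λ Ш(E/K_∞)^∨`).
* `stub_towerRankGrowthReducible` (TRG_red, a THEOREM IN PRINT modulo formalisation, XL): `rank E(K_n) ≤ pⁿ + C₁`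
  — Λ-corank `Sel_{p^∞}(E/K_∞) ≤ 1` (KY Thm 2; classical ⊆ Greenberg Selmer) + Mazur control (finite kernel:
  `E(K_∞)[p^∞]` finite because inert primes split completely in `K_∞`, KY Lemma 1.0.1) + structure theory
  (`rank_{ℤ_p} X_{Γ_n} ≤ pⁿ·rank_Λ X + λ(X_tors)`).
* `stub_herbrandCount` (HC, IMAGE-FREE and SECTOR-FREE pure algebra of the cyclic layers, L): the rank bound
  and the universal-norm datum force a BOUNDED CAPITULATION EXPONENT. Proof on paper (checked in the line
  card): `ker(Ш(E/K) → Ш(E/K_n)) ↪ H¹(G_n, E(K_n))` (inflation–restriction); with `M_n = E(K_n)/tors`,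
  `t = |E(K_∞)_tors| < ∞`: `|H¹(G_n,E(K_n))| ≤ t·|H¹(G_n,M_n)| = t·|Ĥ⁰(G_n,M_n)|/h(M_n)`; the datum gives
  `|Ĥ⁰| ≤ t·p^(n(r_K-1)+c)`; `h(ℤ) = pⁿ`, `h(ℤ[ζ_(p^m)]) = 1/p` give `h(M_n) = p^(n·r_K - Σ_(1≤m≤n) a_m)` where
  `E(K_n) ⊗ ℚ ≅ ⊕_m ℚ(ζ_(p^m))^(a_m)` (the `a_m` do not depend on `n`); so `|H¹| ≤ t²·p^(c + Σ_(m≤n)(a_m - 1))`,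
  and the rank bound `r_K + Σ_(m≤n) a_m φ(p^m) ≤ pⁿ + C₁` forces `a_m ≤ 1` for `p^(m-1)(p-2) > C₁ + 1`, hence
  `Σ_(m≤n)(a_m - 1) ≤ Σ_(a_m ≥ 2)(a_m - 1) < ∞` uniformly in `n`.
* `stub_capitulationSqueezeAnyImage` (SQ, provable now from tree theorems, M): the route's
  `CapitulationSqueeze` with the irreducibility hypothesis deleted (its proof never used it:
  `finite_sha_torsionBy`, `finite_ker_shaRestriction`, divisible of bounded exponent = 0).

Composition `ShaCotorsionReducible_of_stubs : UN_red → CAP_red → TRG_red → HC → SQ → crux` BY NAME (real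
proof, 3 lines: take `K, κ, datum` from UN_red; HC turns TRG_red's bound and the datum into the capitulation
exponent; SQ concludes with CAP_red), and the `NormCapitulation` copy by `rfl`.

## Why it dodges the STUCK goal of the live line `eisenstein_shadow` (lead c4)

c4 is stuck on `stub_shadowBeyondEisensteinDepth` (S_red: a divisible `Ш[p^∞]` at an Eisenstein prime must
cast an even-sign accidental zero at every depth — deep sign-kept visibility / level raising through the
Eisenstein ideal, no engine in print) and on `stub_irrationalShadowsFiniteReducible` (a new non-vanishing
conjecture). This line has NO modular-form side at all: no level raising, no Eisenstein depth, no `A_g`,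
no `Λ(g,1)`. Its open stubs are the bet route's own two conjectures (UN, CAP) restricted to the sector, where
the Λ-adic input is stronger in print than on the irreducible side; its remaining stubs are a theorem in print
(TRG_red), pure algebra (HC) and tree bookkeeping (SQ).

## Disproof used

`Cruxes/ShaCotorsionReducible/Disproof.lean` v4 (cdisprove): NO `_false_without_<H>` theorem is possible
(R ⇐ `SelmerRankShaPFinite` uniformly in every hypothesis), so no stub is obliged to consume a particular
sector hypothesis; the landed Negative lemmas `Theorems/ShaCotorsionReducible/Negative/SectorNonempty*.lean`
((X₀(11),5), (X₁(11),5), (26b1,7)), `PositiveRankMember.lean` ([4,3,3,0,0]: "Sel cotorsion on the sector" is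
FALSE) and `RankTwoMember.lean` (N = 5302, rank ≥ 2: "sector ⇒ rank ≤ 1" is FALSE) are honoured: no stub
bounds a Selmer corank or a Mordell–Weil rank over ℚ; TRG_red bounds `rank E(K_n) - pⁿ`, which is what
Λ-rank one gives at ANY `r_an`. Dead lines: none recorded for this crux (`birth` superseded by
`eisenstein_shadow`, not dead).

## Registration

`ledger skeleton check` REPLACES the item's registered skeleton (no `--alt`), and the lead's
`eisenstein_shadow` records are live, so this file is PUBLISHED (`ledger crux write … Lines/…`) and
self-audited (`#h21_check_skeleton` scratch, evidence note) but NOT registered by the strategist; the lead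
(or its continuation) registers it at a cycle boundary with
`ledger skeleton check $(ledger crux dir stmt-BirchSwinnertonDyer-15277)/Lines/eisenstein_norm_capitulation.lean --crux stmt-BirchSwinnertonDyer-15277`.
-/

-- D-0017: single-problem summit, so `Summit.BirchSwinnertonDyer.BirchSwinnertonDyer.…` repeats a
-- namespace BY DESIGN.
set_option linter.dupNamespace false

namespace Summit.BirchSwinnertonDyer.BirchSwinnertonDyer.Cruxes.ShaCotorsionReducible.EisensteinNormCapitulation

open scoped BigOperators Topology Classical
open Filter Set Function
open Literature

/-! ## §1 Statements (plain `Prop`s over tree vocabulary; `Sig.stub_<name>` ≡ the signature of `stub_<name>`) -/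

/-- **UN_red** — Mazur's `p`-adic universal-norm conjecture on the Eisenstein sector at ONE Heegner field with
`p` split and `d_K` odd (the datum is verbatim that of `NormCapitulation.UniversalNorm`). OPEN (the bet). -/
def Sig.stub_universalNormReducible : Prop :=
  ∀ (V : WeierstrassCurve ℚ) [V.IsElliptic] [V.IsGloballyMinimal] (p : ℕ) [Fact p.Prime], 5 ≤ p → V.HasGoodReductionAtPrime p → ¬ (p : ℤ) ∣ V.frobeniusTrace p → ¬ V.HasIrreducibleModPGaloisRep p → ∃ (K : Type) (_ : Field K) (_ : NumberField K), (Module.finrank ℚ K = 2 ∧ NumberField.IsTotallyComplex K ∧ NumberField.discr K < -4 ∧ Int.gcd (NumberField.discr K) (V.conductorNorm ℤ * p) = 1 ∧ (∀ q : ℕ, q.Prime → q ∣ V.conductorNorm ℤ → ((Ideal.span {(q : ℤ)}).primesOver (NumberField.RingOfIntegers K)).ncard = 2) ∧ ((Ideal.span {(p : ℤ)}).primesOver (NumberField.RingOfIntegers K)).ncard = 2 ∧ Odd (NumberField.discr K)) ∧ ∃ κ : Literature.NumberTheory.EllipticCurves.ZpExtension K p, κ.IsAnticyclotomic ∧ ∃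 c : ℕ, ∀ n : ℕ, ∃ P : (V.baseChange K).geomPoints, (∀ τ ∈ κ.layerSubgroup n, τ • P = P) ∧ ∃ σ : ZMod (p ^ n) → Field.absoluteGaloisGroup K, (∀ a : ZMod (p ^ n), PadicInt.toZModPow n (Multiplicative.toAdd (κ (σ a))) = a) ∧ ∀ Q : (V.baseChange K).geomPoints, (∀ g : Field.absoluteGaloisGroup K, g • Q = Q) → ∀ m : ℕ, 0 < m → m • ((∑ a : ZMod (p ^ n), σ a • P) - p ^ c • Q) ≠ 0

/-- **CAP_red** — phantom capitulation on the Eisenstein sector (verbatim `NormCapitulation.PhantomCapitulation`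
with `E[p]` reducible and the strengthened Heegner block). OPEN (the route's second bet). -/
def Sig.stub_phantomCapitulationReducible : Prop :=
  ∀ (V : WeierstrassCurve ℚ) [V.IsElliptic] [V.IsGloballyMinimal] (p : ℕ) [Fact p.Prime], 5 ≤ p → V.HasGoodReductionAtPrime p → ¬ (p : ℤ) ∣ V.frobeniusTrace p → ¬ V.HasIrreducibleModPGaloisRep p → ∀ (K : Type) [Field K] [NumberField K], (Module.finrank ℚ K = 2 ∧ NumberField.IsTotallyComplex K ∧ NumberField.discr K < -4 ∧ Int.gcd (NumberField.discr K) (V.conductorNorm ℤ * p) = 1 ∧ (∀ q : ℕ, q.Prime → q ∣ V.conductorNorm ℤ → ((Ideal.span {(q : ℤ)}).primesOver (NumberField.RingOfIntegers K)).ncard = 2) ∧ ((Ideal.span {(p : ℤ)}).primesOver (NumberField.RingOfIntegers K)).ncard = 2 ∧ Odd (NumberField.discr K)) → ∀ κ : Literature.NumberTheory.EllipticCurves.ZpExtension K p, κ.IsAnticyclotomic → ∀ ξ : ↥(V.baseChange K).sha, (∃ k : ℕ, p ^ k • ξ = 0) → (∀ k : ℕ, ∃ η : ↥(V.baseChange K).sha,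 p ^ k • η = ξ) → ∃ (n : ℕ) (_ : NumberField ↥(κ.layer n)), Literature.NumberTheory.EllipticCurves.shaRestriction (V.baseChange K) ↥(κ.layer n) ξ = 0

/-- **TRG_red** — tower rank growth on the Eisenstein sector: `rank_ℤ E(K_n) ≤ pⁿ + C₁` along the
anticyclotomic tower (Λ-rank one: Keller–Yin arXiv:2402.12781 Thm 2 / CGLS arXiv:2008.02571 Thm 39, 41 +
Mazur control + structure theory). A theorem in print; formalisation XL. -/
def Sig.stub_towerRankGrowthReducible : Prop :=
  ∀ (V : WeierstrassCurve ℚ) [V.IsElliptic] [V.IsGloballyMinimal] (p : ℕ) [Fact p.Prime], 5 ≤ p → V.HasGoodReductionAtPrime p → ¬ (p : ℤ) ∣ V.frobeniusTrace p → ¬ V.HasIrreducibleModPGaloisRep p → ∀ (K : Type) [Field K] [NumberField K], (Module.finrank ℚ K = 2 ∧ NumberField.IsTotallyComplex K ∧ NumberField.discr K < -4 ∧ Int.gcd (NumberField.discr K) (V.conductorNorm ℤ * p) = 1 ∧ (∀ q : ℕ, q.Prime → q ∣ V.conductorNorm ℤ → ((Ideal.span {(q : ℤ)}).primesOver (NumberField.RingOfIntegers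 K)).ncard = 2) ∧ ((Ideal.span {(p : ℤ)}).primesOver (NumberField.RingOfIntegers K)).ncard = 2 ∧ Odd (NumberField.discr K)) → ∀ κ : Literature.NumberTheory.EllipticCurves.ZpExtension K p, κ.IsAnticyclotomic → ∃ C₁ : ℕ, ∀ (n : ℕ) (s : Finset (V.baseChange K).geomPoints), (∀ P ∈ s, ∀ τ ∈ κ.layerSubgroup n, τ • P = P) → LinearIndependent ℤ (fun P : ↥s => (P : (V.baseChange K).geomPoints)) → s.card ≤ p ^ n + C₁

/-- **HC** — the Herbrand count (IMAGE-FREE, SECTOR-FREE): a tower rank bound and a universal-norm datum force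
a bounded capitulation exponent for `Ш(E/K)[p^∞]` along the layers. Pure algebra of cyclic `p`-power layers
(inflation–restriction, Herbrand quotients `h(ℤ) = pⁿ`, `h(ℤ[ζ_(p^m)]) = 1/p`, finiteness of `E(K_∞)_tors`). -/
def Sig.stub_herbrandCount : Prop :=
  ∀ (V : WeierstrassCurve ℚ) [V.IsElliptic] [V.IsGloballyMinimal] (p : ℕ) [Fact p.Prime], 5 ≤ p → V.HasGoodReductionAtPrime p → ¬ (p : ℤ) ∣ V.frobeniusTrace p → ∀ (K : Type) [Field K] [NumberField K], (Module.finrank ℚ K = 2 ∧ NumberField.IsTotallyComplex K ∧ NumberField.discr K < -4 ∧ Int.gcd (NumberField.discr K) (V.conductorNorm ℤ * p) = 1 ∧ (∀ q : ℕ, q.Prime → q ∣ V.conductorNorm ℤ → ((Ideal.span {(q : ℤ)}).primesOver (NumberField.RingOfIntegers K)).ncard = 2) ∧ ((Ideal.span {(p : ℤ)}).primesOver (NumberField.RingOfIntegers K)).ncard = 2 ∧ Odd (NumberField.discr K)) → ∀ κ : Literature.NumberTheory.EllipticCurves.ZpExtension K p, κ.IsAnticyclotomic → (∃ C₁ : ℕ,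 ∀ (n : ℕ) (s : Finset (V.baseChange K).geomPoints), (∀ P ∈ s, ∀ τ ∈ κ.layerSubgroup n, τ • P = P) → LinearIndependent ℤ (fun P : ↥s => (P : (V.baseChange K).geomPoints)) → s.card ≤ p ^ n + C₁) → (∃ c : ℕ, ∀ n : ℕ, ∃ P : (V.baseChange K).geomPoints, (∀ τ ∈ κ.layerSubgroup n, τ • P = P) ∧ ∃ σ : ZMod (p ^ n) → Field.absoluteGaloisGroup K, (∀ a : ZMod (p ^ n), PadicInt.toZModPow n (Multiplicative.toAdd (κ (σ a))) = a) ∧ ∀ Q : (V.baseChange K).geomPoints, (∀ g : Field.absoluteGaloisGroup K, g • Q = Q) → ∀ m : ℕ, 0 < m → m • ((∑ a : ZMod (p ^ n), σ a • P) - p ^ c • Q) ≠ 0) → ∃ C : ℕ, ∀ (n : ℕ) (_ : NumberField ↥(κ.layer n)) (ξ : ↥(V.baseChange K).sha), (∃ k : ℕ, p ^ k • ξ = 0) → Literature.NumberTheory.EllipticCurves.shaRestriction (V.baseChange K) ↥(κ.layer n) ξ = 0 → p ^ C • ξ = 0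

/-- **SQ** — capitulation squeeze for ANY mod-`p` image (the route's `CapitulationSqueeze` with the
irreducibility hypothesis deleted; provable now from `finite_sha_torsionBy`, `finite_ker_shaRestriction`). -/
def Sig.stub_capitulationSqueezeAnyImage : Prop :=
  ∀ (V : WeierstrassCurve ℚ) [V.IsElliptic] [V.IsGloballyMinimal] (p : ℕ) [Fact p.Prime], 5 ≤ p → V.HasGoodReductionAtPrime p → ¬ (p : ℤ) ∣ V.frobeniusTrace p → ∀ (K : Type) [Field K] [NumberField K], (Module.finrank ℚ K = 2 ∧ NumberField.IsTotallyComplex K ∧ NumberField.discr K < -4 ∧ Int.gcd (NumberField.discr K) (V.conductorNorm ℤ * p) = 1 ∧ (∀ q : ℕ, q.Prime → q ∣ V.conductorNorm ℤ → ((Ideal.span {(q : ℤ)}).primesOver (NumberField.RingOfIntegers K)).ncard = 2) ∧ ((Ideal.span {(p : ℤ)}).primesOver (NumberField.RingOfIntegers K)).ncard = 2 ∧ Odd (NumberField.discr K)) → ∀ κ : Literature.NumberTheory.EllipticCurves.ZpExtension K p, κ.IsAnticyclotomic → (∀ ξ : ↥(V.baseChange K).sha, (∃ k : ℕ, p ^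 k • ξ = 0) → (∀ k : ℕ, ∃ η : ↥(V.baseChange K).sha, p ^ k • η = ξ) → ∃ (n : ℕ) (_ : NumberField ↥(κ.layer n)), Literature.NumberTheory.EllipticCurves.shaRestriction (V.baseChange K) ↥(κ.layer n) ξ = 0) → (∃ C : ℕ, ∀ (n : ℕ) (_ : NumberField ↥(κ.layer n)) (ξ : ↥(V.baseChange K).sha), (∃ k : ℕ, p ^ k • ξ = 0) → Literature.NumberTheory.EllipticCurves.shaRestriction (V.baseChange K) ↥(κ.layer n) ξ = 0 → p ^ C • ξ = 0) → V.shaCorank p = 0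

/-! ## §2 Stubs (to be registered; `sorry` only here; statements INLINED = the signatures to register) -/

/-- **Stub UN_red (load-bearing, OPEN).** [conjecture: Mazur 1984 ICM universal norms, indefinite case;
Bertolini 1995 (needs `p ∤ [E(K):ℤy_K]`); CGLS arXiv:2008.02571 Rem. 42; Keller–Yin arXiv:2402.12781 Thm 2] -/
theorem stub_universalNormReducible :
    ∀ (V : WeierstrassCurve ℚ) [V.IsElliptic] [V.IsGloballyMinimal] (p : ℕ) [Fact p.Prime], 5 ≤ p → V.HasGoodReductionAtPrime p → ¬ (p : ℤ) ∣ V.frobeniusTrace p → ¬ V.HasIrreducibleModPGaloisRep p → ∃ (K : Type) (_ : Field K) (_ : NumberField K), (Module.finrank ℚ K = 2 ∧ NumberField.IsTotallyComplex K ∧ NumberField.discr K < -4 ∧ Int.gcd (NumberField.discr K) (V.conductorNorm ℤ * p) = 1 ∧ (∀ q : ℕ, q.Prime → q ∣ V.conductorNorm ℤ → ((Ideal.span {(q : ℤ)}).primesOver (NumberField.RingOfIntegers K)).ncard = 2) ∧ ((Ideal.span {(p : ℤ)}).primesOver (NumberField.RingOfIntegers K)).ncard = 2 ∧ Odd (NumberField.discr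 K)) ∧ ∃ κ : Literature.NumberTheory.EllipticCurves.ZpExtension K p, κ.IsAnticyclotomic ∧ ∃ c : ℕ, ∀ n : ℕ, ∃ P : (V.baseChange K).geomPoints, (∀ τ ∈ κ.layerSubgroup n, τ • P = P) ∧ ∃ σ : ZMod (p ^ n) → Field.absoluteGaloisGroup K, (∀ a : ZMod (p ^ n), PadicInt.toZModPow n (Multiplicative.toAdd (κ (σ a))) = a) ∧ ∀ Q : (V.baseChange K).geomPoints, (∀ g : Field.absoluteGaloisGroup K, g • Q = Q) → ∀ m : ℕ, 0 < m → m • ((∑ a : ZMod (p ^ n), σ a • P) - p ^ c • Q) ≠ 0 := by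
  sorry

/-- **Stub CAP_red (OPEN).** [conjecture: NormCapitulation #3 on the sector; Bertolini 1995; Greenberg LNM 1716] -/
theorem stub_phantomCapitulationReducible :
    ∀ (V : WeierstrassCurve ℚ) [V.IsElliptic] [V.IsGloballyMinimal] (p : ℕ) [Fact p.Prime], 5 ≤ p → V.HasGoodReductionAtPrime p → ¬ (p : ℤ) ∣ V.frobeniusTrace p → ¬ V.HasIrreducibleModPGaloisRep p → ∀ (K : Type) [Field K] [NumberField K], (Module.finrank ℚ K = 2 ∧ NumberField.IsTotallyComplex K ∧ NumberField.discr K < -4 ∧ Int.gcd (NumberField.discr K) (V.conductorNorm ℤ * p) = 1 ∧ (∀ q : ℕ, q.Prime → q ∣ V.conductorNorm ℤ → ((Ideal.span {(q : ℤ)}).primesOver (NumberField.RingOfIntegers K)).ncard = 2) ∧ ((Ideal.span {(p : ℤ)}).primesOver (NumberField.RingOfIntegers K)).ncard = 2 ∧ Odd (NumberField.discr K)) → ∀ κ : Literature.NumberTheory.EllipticCurves.ZpExtension K p, κ.IsAnticyclotomic → ∀ ξ : ↥(V.baseChange K).sha, (∃ k : ℕ, p ^ k • ξ = 0) → (∀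 k : ℕ, ∃ η : ↥(V.baseChange K).sha, p ^ k • η = ξ) → ∃ (n : ℕ) (_ : NumberField ↥(κ.layer n)), Literature.NumberTheory.EllipticCurves.shaRestriction (V.baseChange K) ↥(κ.layer n) ξ = 0 := by
  sorry

/-- **Stub TRG_red (theorem in print, unformalised).** [Keller–Yin arXiv:2402.12781 Thm 2 + Lemma 1.0.1;
CGLS arXiv:2008.02571 Thm 39/41; Greenberg LNM 1716 §3 (control); Mazur 1972] -/
theorem stub_towerRankGrowthReducible :
    ∀ (V : WeierstrassCurve ℚ) [V.IsElliptic] [V.IsGloballyMinimal] (p : ℕ) [Fact p.Prime], 5 ≤ p → V.HasGoodReductionAtPrime p → ¬ (p : ℤ) ∣ V.frobeniusTrace p → ¬ V.HasIrreducibleModPGaloisRep p → ∀ (K : Type) [Field K] [NumberField K], (Module.finrank ℚ K = 2 ∧ NumberField.IsTotallyComplex K ∧ NumberField.discr K < -4 ∧ Int.gcd (NumberField.discr K) (V.conductorNorm ℤ * p) = 1 ∧ (∀ q : ℕ, q.Prime → q ∣ V.conductorNorm ℤ → ((Ideal.span {(q : ℤ)}).primesOver (NumberField.RingOfIntegers K)).ncard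 = 2) ∧ ((Ideal.span {(p : ℤ)}).primesOver (NumberField.RingOfIntegers K)).ncard = 2 ∧ Odd (NumberField.discr K)) → ∀ κ : Literature.NumberTheory.EllipticCurves.ZpExtension K p, κ.IsAnticyclotomic → ∃ C₁ : ℕ, ∀ (n : ℕ) (s : Finset (V.baseChange K).geomPoints), (∀ P ∈ s, ∀ τ ∈ κ.layerSubgroup n, τ • P = P) → LinearIndependent ℤ (fun P : ↥s => (P : (V.baseChange K).geomPoints)) → s.card ≤ p ^ n + C₁ := by
  sorry

/-- **Stub HC (pure algebra, L).** [Yu, Israel J. Math. 2004 doi:10.1007/bf02772219 (H¹(G,E(L)) and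
capitulation); Serre, Local Fields VIII (Herbrand quotient); Bertolini–Darmon 1990 (norms in the
anticyclotomic tower)] -/
theorem stub_herbrandCount :
    ∀ (V : WeierstrassCurve ℚ) [V.IsElliptic] [V.IsGloballyMinimal] (p : ℕ) [Fact p.Prime], 5 ≤ p → V.HasGoodReductionAtPrime p → ¬ (p : ℤ) ∣ V.frobeniusTrace p → ∀ (K : Type) [Field K] [NumberField K], (Module.finrank ℚ K = 2 ∧ NumberField.IsTotallyComplex K ∧ NumberField.discr K < -4 ∧ Int.gcd (NumberField.discr K) (V.conductorNorm ℤ * p) = 1 ∧ (∀ q : ℕ, q.Prime → q ∣ V.conductorNorm ℤ → ((Ideal.span {(q : ℤ)}).primesOver (NumberField.RingOfIntegers K)).ncard = 2) ∧ ((Ideal.span {(p : ℤ)}).primesOver (NumberField.RingOfIntegers K)).ncard = 2 ∧ Odd (NumberField.discr K)) → ∀ κ : Literature.NumberTheory.EllipticCurves.ZpExtension K p, κ.IsAnticyclotomic → (∃ C₁ : ℕ, ∀ (n : ℕ) (s : Finset (V.baseChange K).geomPoints), (∀ P ∈ s, ∀ τ ∈ κ.layerSubgroup n, τ • P = P) →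 LinearIndependent ℤ (fun P : ↥s => (P : (V.baseChange K).geomPoints)) → s.card ≤ p ^ n + C₁) → (∃ c : ℕ, ∀ n : ℕ, ∃ P : (V.baseChange K).geomPoints, (∀ τ ∈ κ.layerSubgroup n, τ • P = P) ∧ ∃ σ : ZMod (p ^ n) → Field.absoluteGaloisGroup K, (∀ a : ZMod (p ^ n), PadicInt.toZModPow n (Multiplicative.toAdd (κ (σ a))) = a) ∧ ∀ Q : (V.baseChange K).geomPoints, (∀ g : Field.absoluteGaloisGroup K, g • Q = Q) → ∀ m : ℕ, 0 < m → m • ((∑ a : ZMod (p ^ n), σ a • P) - p ^ c • Q) ≠ 0) → ∃ C : ℕ, ∀ (n : ℕ) (_ : NumberField ↥(κ.layer n)) (ξ : ↥(V.baseChange K).sha), (∃ k : ℕ, p ^ k • ξ = 0) → Literature.NumberTheory.EllipticCurves.shaRestriction (V.baseChange K) ↥(κ.layer n) ξ = 0 → p ^ C • ξ = 0 := by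
  sorry

/-- **Stub SQ (tree bookkeeping, M).** [Greenberg LNM 1716; Silverman AEC X.4; tree: `finite_sha_torsionBy`,
`finite_ker_shaRestriction`] -/
theorem stub_capitulationSqueezeAnyImage :
    ∀ (V : WeierstrassCurve ℚ) [V.IsElliptic] [V.IsGloballyMinimal] (p : ℕ) [Fact p.Prime], 5 ≤ p → V.HasGoodReductionAtPrime p → ¬ (p : ℤ) ∣ V.frobeniusTrace p → ∀ (K : Type) [Field K] [NumberField K], (Module.finrank ℚ K = 2 ∧ NumberField.IsTotallyComplex K ∧ NumberField.discr K < -4 ∧ Int.gcd (NumberField.discr K) (V.conductorNorm ℤ * p) = 1 ∧ (∀ q : ℕ, q.Prime → q ∣ V.conductorNorm ℤ → ((Ideal.span {(q : ℤ)}).primesOver (NumberField.RingOfIntegers K)).ncard = 2) ∧ ((Ideal.span {(p : ℤ)}).primesOver (NumberField.RingOfIntegers K)).ncard = 2 ∧ Odd (NumberField.discr K)) → ∀ κ : Literature.NumberTheory.EllipticCurves.ZpExtension K p, κ.IsAnticyclotomic → (∀ ξ : ↥(V.baseChange K).sha, (∃ k : ℕ, p ^ k • ξ = 0) → (∀ k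 : ℕ, ∃ η : ↥(V.baseChange K).sha, p ^ k • η = ξ) → ∃ (n : ℕ) (_ : NumberField ↥(κ.layer n)), Literature.NumberTheory.EllipticCurves.shaRestriction (V.baseChange K) ↥(κ.layer n) ξ = 0) → (∃ C : ℕ, ∀ (n : ℕ) (_ : NumberField ↥(κ.layer n)) (ξ : ↥(V.baseChange K).sha), (∃ k : ℕ, p ^ k • ξ = 0) → Literature.NumberTheory.EllipticCurves.shaRestriction (V.baseChange K) ↥(κ.layer n) ξ = 0 → p ^ C • ξ = 0) → V.shaCorank p = 0 := by
  sorry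

/-! ## §3 Composition (real proofs, no `sorry`) -/

/-- **Composition from the stubs (the theorem the skeleton audit keys on).** UN_red, CAP_red, TRG_red, HC and
SQ imply the crux BY NAME: take the Heegner field, the anticyclotomic extension and the universal-norm datum
from UN_red; HC turns TRG_red's rank bound and the datum into a bounded capitulation exponent; SQ concludes
with CAP_red. [folklore] -/
theorem ShaCotorsionReducible_of_stubs : Sig.stub_universalNormReducible →
    Sig.stub_phantomCapitulationReducible → Sig.stub_towerRankGrowthReducible → Sig.stub_herbrandCount →
    Sig.stub_capitulationSqueezeAnyImage →
    Summit.BirchSwinnertonDyer.BirchSwinnertonDyer.Theses.ShadowIsolation.ShaCotorsionReducible := by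
  intro hUN hCap hTRG hHC hSq W _ _ p _ h5 hgood hord hred
  obtain ⟨K, iK, iNK, hK, κ, hκ, hdatum⟩ := hUN W p h5 hgood hord hred
  exact hSq W p h5 hgood hord K hK κ hκ (hCap W p h5 hgood hord hred K hK κ hκ)
    (hHC W p h5 hgood hord K hK κ hκ (hTRG W p h5 hgood hord hred K hK κ hκ) hdatum)

/-- The same composition concluding the `NormCapitulation` copy of the crux (the two route decls are
`rfl`-equal). [folklore] -/
theorem NormCapitulation_ShaCotorsionReducible_of_stubs : Sig.stub_universalNormReducible →
    Sig.stub_phantomCapitulationReducible → Sig.stub_towerRankGrowthReducible → Sig.stub_herbrandCount →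
    Sig.stub_capitulationSqueezeAnyImage →
    Summit.BirchSwinnertonDyer.BirchSwinnertonDyer.Theses.NormCapitulation.ShaCotorsionReducible :=
  ShaCotorsionReducible_of_stubs

/-- **Target.** The crux decl from the five stubs through `ShaCotorsionReducible_of_stubs` (closed = false:
its closure reaches `sorryAx` exactly through the five `stub_*`). -/
theorem ShaCotorsionReducible_skeleton :
    Summit.BirchSwinnertonDyer.BirchSwinnertonDyer.Theses.ShadowIsolation.ShaCotorsionReducible :=
  ShaCotorsionReducible_of_stubs stub_universalNormReducible stub_phantomCapitulationReducible
    stub_towerRankGrowthReducible stub_herbrandCount stub_capitulationSqueezeAnyImage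

end Summit.BirchSwinnertonDyer.BirchSwinnertonDyer.Cruxes.ShaCotorsionReducible.EisensteinNormCapitulation
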